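import Literature.AlgebraicGeometry.GroupSchemes.ConnectedEtaleIdempotent            -- FILE A: `ConnectedEtaleSplitting`, `S.idem`, naturality, canonicity
import Literature.AlgebraicGeometry.GroupSchemes.BarsottiTateGroupFixedPartMap       -- ★ (O-BTε) `fixBTGroup`, `fixBTGroupι`, `fixRestrict`, `comp_fixBTGroupι_injective`
import Literature.AlgebraicGeometry.GroupSchemes.BarsottiTateGroupFixedPartHeight    -- ★ `exists_finrank_fixLayer_eq_pow`, `finrank_fixLayer_mul_finrank_ker`
import Literature.AlgebraicGeometry.GroupSchemes.BTGroupNilpotentPoints              -- ★ `IsRingActionBT`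
import HarnessLib

/-!
# The connected part `B⁰` of a Barsotti–Tate group over an algebraically closed field ([Tate 1967] (2.4); [Messing 1972] II (3.3.18))

Topic `Literature/AlgebraicGeometry/GroupSchemes`; namespace `Literature.AlgebraicGeometry.GroupSchemes.BTGroup`.  DEFINITIONS (the
connected–étale idempotent `B.connectedEtaleIdem : Hom B B`, the height `B.connectedPartHeight`, the connected part `B.connectedPart`,
its inclusion `B.connectedPartι` and the restricted action `B.connectedPartAction β`) + fully proved theorems; no named fact, no instance, no
notation, no `sorry`.  Cell `hodgecm-mathlib` (D-0151), P6 «MOD programme», sub-desk F0P6b «ONE-DIMENSIONAL BLOCK NUMERICS» kit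
`Cruxes/HLiu418/Lines/F0_P6b_BlockNumerics.lean` ED. 1 (F0P6b-plan (g2), cand 49deda72, CUT OF RECORD 17:07:22Z): organ (n0) FILE B = the CLOSER
of `stub_N1_unitComponentBTGroup` (text reproduced by `exists_connectedPart_ringAction`, one `exact` at ED. 2).  HC_CM is proved only modulo the
printed citations until rung 0 closes; nothing here is about HC.

THE PRINT.  [Tate1967] (2.4) (cf. [Messing1972] Ch. II (3.3.18), [Tate1997FiniteFlatGroupSchemes] (3.7)): for a `p`-divisible group `G = (G_ν)`
over a henselian local base the unit components `G_ν⁰` form a `p`-divisible group `G⁰` (the CONNECTED PART) and `G_ν ↦ G_ν^{ét}` an étale one,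
`0 → G⁰ → G → G^{ét} → 0`; over a perfect field the sequence splits.  HERE, over an ALGEBRAICALLY CLOSED field `k`: the layer-wise connected–étale
idempotents `ε_n` (FILE A `ConnectedEtaleSplitting.idem`: project `G_n = G_n⁰ × (G_n)_red` onto `G_n⁰`) are CANONICAL and NATURAL for every
homomorphism (★ `ConnectedEtaleSplitting.comp_idem_eq_idem_comp`), hence assemble to an IDEMPOTENT ENDOMORPHISM `ε` of the Barsotti–Tate group
`B`; its fixed part (★ `BTGroup.Hom.fixBTGroup`, the splitting theorem ★ `exists_btGroup_hom_of_idempotent` supplying the height) IS the connected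
part: a Barsotti–Tate group `B⁰` of height `H⁰ ≤ H` whose layers are the unit components of the `B.G n` (open-and-closed, connected), and every
endomorphism of `B` — in particular a ring action `β` — restricts to `B⁰` (★ `fixRestrict`), as a ring action.

MAIN STATEMENTS.  §1 `ceSplitting` (the chosen splitting of a layer), `connectedEtaleIdem` + `connectedEtaleIdem_comp_self`, `comp_connectedEtaleIdem_eq`
(naturality for every endomorphism of `B`); §2 `connectedPartHeight`, `connectedPart`, `connectedPartι`, `isOpenImmersion_connectedPartι_app`,
`isClosedImmersion_connectedPartι_app`, `connectedSpace_connectedPart`, `connectedPartHeight_le`, the universal property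
`exists_comp_connectedPartι_eq_iff`; §3 `connectedPartAction`, `connectedPartAction_comp_ι`, `isRingActionBT_connectedPartAction`; §4 HEAD
**`exists_connectedPart_ringAction`** = the text of `stub_N1_unitComponentBTGroup`.

## References
* [Tate1967] J. T. Tate, *p-divisible groups*, Proc. Conf. Local Fields (Driebergen, 1966), Springer (1967), §2.2 and (2.4).
* [Messing1972] W. Messing, *The Crystals Associated to Barsotti–Tate Groups*, LNM 264 (1972), Ch. II (3.3.18).
* [Tate1997FiniteFlatGroupSchemes] J. Tate, *Finite flat group schemes*, in: Modular Forms and Fermat's Last Theorem (1997), (3.7).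
-/

set_option autoImplicit false

noncomputable section

universe u v

open CategoryTheory CategoryTheory.Limits AlgebraicGeometry MonoidalCategory CartesianMonoidalCategory
open scoped MonObj

namespace Literature.AlgebraicGeometry.GroupSchemes

namespace BTGroup

variable {k : Type u} [Field k] [IsAlgClosed k] {p H : ℕ} (B : BTGroup (Spec (.of k)) p H)

/-! ## §1 The connected–étale idempotent of a Barsotti–Tate group over `k̄` -/

/-- **The chosen connected–étale splitting `G_n⁰ ↪ G_n ↩ (G_n)_red` of the `n`-th layer** (★ `nonempty_connectedEtaleSplitting`; any two
choices give the same idempotent, ★ `ConnectedEtaleSplitting.idem_eq`). [cite: Tate1997FiniteFlatGroupSchemes, (3.7)] -/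
def ceSplitting (n : ℕ) : letI := B.grpObj n; ConnectedEtaleSplitting (B.G n) :=
  letI := B.grpObj n
  haveI := B.comm n
  haveI : IsFinite (B.G n).hom := B.isFinite n
  Classical.choice (nonempty_connectedEtaleSplitting (B.G n))

/-- **THE CONNECTED–ÉTALE IDEMPOTENT `ε : B → B`**: layers `ε_n` = the projection of `G_n = G_n⁰ × (G_n)_red` onto `G_n⁰` (FILE A), homomorphisms,
compatible with the transitions by NATURALITY of the layer idempotents (★ `ConnectedEtaleSplitting.comp_idem_eq_idem_comp` for `incl n`).
[cite: Tate1967, (2.4)] [cite: Tate1997FiniteFlatGroupSchemes, (3.7)] -/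
def connectedEtaleIdem : Hom B B where
  app n := letI := B.grpObj n; (B.ceSplitting n).idem
  isMonHom_app n := by
    letI := B.grpObj n
    haveI := B.comm n
    exact (B.ceSplitting n).isMonHom_idem
  incl_comp_app n := by
    letI := B.grpObj n
    letI := B.grpObj (n + 1)
    haveI := B.comm n
    haveI := B.comm (n + 1)
    haveI : IsFinite (B.G (n + 1)).hom := B.isFinite (n + 1)
    haveI := B.incl_isMonHom n
    exact (B.ceSplitting n).comp_idem_eq_idem_comp (B.ceSplitting (n + 1)) (B.incl n)

/-- Unfolding: `ε_n` is the idempotent of the chosen splitting of the `n`-th layer. [cite: Tate1997FiniteFlatGroupSchemes, (3.7)] -/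
theorem connectedEtaleIdem_app (n : ℕ) : B.connectedEtaleIdem.app n = (letI := B.grpObj n; (B.ceSplitting n).idem) := rfl

/-- **`ε ≫ ε = ε`** (layer-wise ★ `ConnectedEtaleSplitting.idem_comp_idem`). [cite: Tate1967, (2.4)] -/
theorem connectedEtaleIdem_comp_self (n : ℕ) :
    B.connectedEtaleIdem.app n ≫ B.connectedEtaleIdem.app n = B.connectedEtaleIdem.app n := by
  letI := B.grpObj n
  exact (B.ceSplitting n).idem_comp_idem

/-- **Every endomorphism of `B` commutes with `ε`** (naturality of the layer idempotents for every homomorphism, FILE A).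
[cite: Tate1967, (2.4)] [cite: Tate1997FiniteFlatGroupSchemes, (3.7)] -/
theorem comp_connectedEtaleIdem_eq (φ : Hom B B) (n : ℕ) :
    φ.app n ≫ B.connectedEtaleIdem.app n = B.connectedEtaleIdem.app n ≫ φ.app n := by
  letI := B.grpObj n
  haveI := B.comm n
  haveI : IsFinite (B.G n).hom := B.isFinite n
  haveI := φ.isMonHom_app n
  exact (B.ceSplitting n).comp_idem_eq_idem_comp (B.ceSplitting n) (φ.app n)

/-- The points of `G_n` fixed by `ε_n` are exactly those of the unit component `G_n⁰` of the chosen splitting. [cite: Tate1997FiniteFlatGroupSchemes, (3.7)] -/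
theorem comp_connectedEtaleIdem_eq_self_iff (n : ℕ) {T : Over (Spec (.of k))} (t : T ⟶ B.G n) :
    t ≫ B.connectedEtaleIdem.app n = t ↔ ∃ t₀ : T ⟶ (letI := B.grpObj n; (B.ceSplitting n).G₀), t₀ ≫ (letI := B.grpObj n; (B.ceSplitting n).j) = t := by
  letI := B.grpObj n
  exact (B.ceSplitting n).comp_idem_eq_self_iff t

/-! ## §2 The connected part `B⁰ := Fix ε` -/

section Part

variable [Fact p.Prime]

/-- The height `H⁰` of the connected part: the exponent with `rk Fix ε_n = p^{n H⁰}` (★ `exists_finrank_fixLayer_eq_pow`, `p` prime, `k` local).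
[cite: Tate1967, (2.4)] -/
def connectedPartHeight : ℕ :=
  (B.connectedEtaleIdem.exists_finrank_fixLayer_eq_pow (Fact.out : p.Prime) B.connectedEtaleIdem_comp_self).choose

/-- The defining rank function of `H⁰`. [cite: Tate1967, (2.4)] -/
theorem finrank_fixLayer_connectedEtaleIdem (n : ℕ) (s : Spec (.of k)) :
    (B.connectedEtaleIdem.fixLayer n).hom.finrank s = p ^ (n * B.connectedPartHeight) :=
  (B.connectedEtaleIdem.exists_finrank_fixLayer_eq_pow (Fact.out : p.Prime) B.connectedEtaleIdem_comp_self).choose_spec n s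

/-- **THE CONNECTED PART `B⁰`** of a Barsotti–Tate group over an algebraically closed field: the fixed part of the connected–étale idempotent
(★ `fixBTGroup`), a Barsotti–Tate group of height `H⁰`. [cite: Tate1967, (2.4)] [cite: Messing1972, Ch. II (3.3.18)] -/
def connectedPart : BTGroup (Spec (.of k)) p B.connectedPartHeight :=
  B.connectedEtaleIdem.fixBTGroup B.connectedEtaleIdem_comp_self B.connectedPartHeight B.finrank_fixLayer_connectedEtaleIdem

/-- **The inclusion `ι : B⁰ → B`** (★ `fixBTGroupι`). [cite: Tate1967, (2.4)] -/
def connectedPartι : Hom B.connectedPart B :=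
  B.connectedEtaleIdem.fixBTGroupι B.connectedEtaleIdem_comp_self B.connectedPartHeight B.finrank_fixLayer_connectedEtaleIdem

/-- Unfolding: the layers of `ι` are the inclusions `Fix ε_n ↪ G_n`. [cite: Tate1967, (2.4)] -/
theorem connectedPartι_app (n : ℕ) : B.connectedPartι.app n = B.connectedEtaleIdem.fixLayerι n := rfl

/-- **UNIVERSAL PROPERTY**: a `T`-valued point of `G_n` factors through `B⁰.G n` iff it is fixed by `ε_n`, iff it factors through the unit component
(★ `existsUnique_comp_fixLayerι_eq`, FILE A `comp_idem_eq_self_iff`). [cite: Tate1967, (2.4)] [cite: Tate1997FiniteFlatGroupSchemes, (3.7)] -/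
theorem exists_comp_connectedPartι_eq_iff (n : ℕ) {T : Over (Spec (.of k))} (t : T ⟶ B.G n) :
    (∃ s : T ⟶ B.connectedPart.G n, s ≫ B.connectedPartι.app n = t) ↔ t ≫ B.connectedEtaleIdem.app n = t := by
  refine ⟨fun ⟨s, hs⟩ => ?_, fun ht => ?_⟩
  · rw [← hs, Category.assoc]
    exact congrArg (fun f => s ≫ f) (B.connectedEtaleIdem.fixLayerι_comp n)
  · exact (B.connectedEtaleIdem.existsUnique_comp_fixLayerι_eq n t ht).exists

/-- **The chosen unit component `G_n⁰` IS the layer `B⁰.G n`**: an isomorphism over `G_n` (both represent «points fixed by `ε_n`»).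
[cite: Tate1967, (2.4)] [cite: Tate1997FiniteFlatGroupSchemes, (3.7)] -/
theorem exists_iso_ceSplitting_G₀ (n : ℕ) :
    ∃ e : (letI := B.grpObj n; (B.ceSplitting n).G₀) ≅ B.connectedPart.G n,
      e.hom ≫ B.connectedPartι.app n = (letI := B.grpObj n; (B.ceSplitting n).j) := by
  letI := B.grpObj n
  set S := B.ceSplitting n with hS
  -- `j` is fixed by `ε_n`, so it factors through `Fix ε_n = B⁰.G n`
  obtain ⟨s, hs⟩ : ∃ s : S.G₀ ⟶ B.connectedPart.G n, s ≫ B.connectedPartι.app n = S.j :=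
    (B.exists_comp_connectedPartι_eq_iff n S.j).mpr S.j_comp_idem
  -- `ι_n` is fixed by `ε_n`, so it factors through `j`
  obtain ⟨t, ht⟩ : ∃ t : B.connectedPart.G n ⟶ S.G₀, t ≫ S.j = B.connectedPartι.app n :=
    (S.comp_idem_eq_self_iff (B.connectedPartι.app n)).mp (B.connectedEtaleIdem.fixLayerι_comp n)
  haveI : Mono S.j := by haveI := S.isClosedImmersion_j; exact Over.mono_of_mono_left _
  haveI : Mono (B.connectedPartι.app n) := B.connectedEtaleIdem.mono_fixLayerι n
  refine ⟨⟨s, t, ?_, ?_⟩, hs⟩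
  · rw [← cancel_mono S.j, Category.assoc, ht, hs, Category.id_comp]
  · rw [← cancel_mono (B.connectedPartι.app n), Category.assoc, hs, ht, Category.id_comp]

/-- The layers of `ι : B⁰ → B` are OPEN immersions (they are the unit components). [cite: Tate1997FiniteFlatGroupSchemes, (3.7)] -/
theorem isOpenImmersion_connectedPartι_app (n : ℕ) : IsOpenImmersion (B.connectedPartι.app n).left := by
  letI := B.grpObj n
  obtain ⟨e, he⟩ := B.exists_iso_ceSplitting_G₀ n
  haveI := (B.ceSplitting n).isOpenImmersion_j
  have h : (B.connectedPartι.app n).left = e.inv.left ≫ (B.ceSplitting n).j.left := by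
    rw [← Over.comp_left, ← he, e.inv_hom_id_assoc]
  rw [h]
  infer_instance

/-- The layers of `ι : B⁰ → B` are CLOSED immersions. [cite: Tate1997FiniteFlatGroupSchemes, (3.7)] -/
theorem isClosedImmersion_connectedPartι_app (n : ℕ) : IsClosedImmersion (B.connectedPartι.app n).left :=
  B.connectedEtaleIdem.isClosedImmersion_fixLayerι_left n

/-- **The layers of `B⁰` are CONNECTED** (homeomorphic to the unit components). [cite: Tate1967, (2.4)] [cite: Tate1997FiniteFlatGroupSchemes, (3.7)] -/
theorem connectedSpace_connectedPart (n : ℕ) : ConnectedSpace ↥(B.connectedPart.G n).left := by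
  letI := B.grpObj n
  obtain ⟨e, -⟩ := B.exists_iso_ceSplitting_G₀ n
  haveI := (B.ceSplitting n).connectedSpace_G₀
  have e' : (B.ceSplitting n).G₀.left ≅ (B.connectedPart.G n).left :=
    ⟨e.hom.left, e.inv.left, by rw [← Over.comp_left, e.hom_inv_id, Over.id_left], by rw [← Over.comp_left, e.inv_hom_id, Over.id_left]⟩
  exact (Scheme.homeoOfIso e').surjective.connectedSpace (Scheme.homeoOfIso e').continuous

/-- **`H⁰ ≤ H`**: `rk B⁰.G 1 = p^{H⁰}` divides `rk G_1 = p^H` (★ `finrank_fixLayer_mul_finrank_ker`). [cite: Tate1967, (2.4)] -/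
theorem connectedPartHeight_le : B.connectedPartHeight ≤ H := by
  have hp : p.Prime := Fact.out
  let s : Spec (.of k) := (IsLocalRing.closedPoint k : PrimeSpectrum k)
  have h1 := B.connectedEtaleIdem.finrank_fixLayer_mul_finrank_ker B.connectedEtaleIdem_comp_self 1 s
  rw [B.finrank_fixLayer_connectedEtaleIdem 1 s, one_mul, one_mul] at h1
  exact (Nat.pow_dvd_pow_iff_le_right hp.one_lt).mp (Dvd.intro _ h1)

end Part

/-! ## §3 Endomorphisms restrict to the connected part; ring actions restrict as ring actions -/

section Action

variable [Fact p.Prime] {𝒪 : Type v} (β : 𝒪 → Hom B B)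

/-- **The restricted action `β⁰ : 𝒪 → End(B⁰)`**: every `β a` commutes with `ε` (§1), hence restricts to `Fix ε = B⁰` (★ `fixRestrict`).
[cite: Tate1967, (2.4)] [cite: Tate1997FiniteFlatGroupSchemes, (3.7)] -/
def connectedPartAction (a : 𝒪) : Hom B.connectedPart B.connectedPart :=
  Hom.fixRestrict B.connectedEtaleIdem B.connectedEtaleIdem_comp_self B.connectedPartHeight B.finrank_fixLayer_connectedEtaleIdem
    B.connectedEtaleIdem B.connectedEtaleIdem_comp_self B.connectedPartHeight B.finrank_fixLayer_connectedEtaleIdem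
    (β a) (B.comp_connectedEtaleIdem_eq (β a))

/-- **`β⁰ a ≫ ι = ι ≫ β a`**: the restricted action is compatible with the inclusion (★ `fixRestrict_comp_fixBTGroupι`). [cite: Tate1967, (2.4)] -/
theorem connectedPartAction_comp_ι (a : 𝒪) : (B.connectedPartAction β a).comp B.connectedPartι = B.connectedPartι.comp (β a) :=
  Hom.fixRestrict_comp_fixBTGroupι _ _ _ _ _ _ _ _ _ _

/-- **A RING ACTION RESTRICTS AS A RING ACTION**: `β⁰ 1 = id`, `β⁰ (ab) = β⁰ b ∘ β⁰ a`, `β⁰ (a + b) = β⁰ a + β⁰ b` layer-wise — each identity is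
checked after the layer monomorphisms `ι_n` (homomorphisms), where it is the corresponding identity for `β`. [cite: Tate1967, §2.2 and (2.4)] -/
theorem isRingActionBT_connectedPartAction [CommRing 𝒪] (hβ : IsRingActionBT B β) :
    IsRingActionBT B.connectedPart (B.connectedPartAction β) := by
  obtain ⟨h1, hmul, hadd⟩ := hβ
  refine ⟨?_, fun a b => ?_, fun a b n => ?_⟩
  · -- `β⁰ 1 = id`
    apply Hom.comp_fixBTGroupι_injective B.connectedEtaleIdem B.connectedEtaleIdem_comp_self B.connectedPartHeight
      B.finrank_fixLayer_connectedEtaleIdem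
    change (B.connectedPartAction β 1).comp B.connectedPartι = (Hom.id _).comp B.connectedPartι
    rw [connectedPartAction_comp_ι, h1, Hom.comp_id, Hom.id_comp]
  · -- `β⁰ (a * b) = β⁰ b ∘ β⁰ a`
    apply Hom.comp_fixBTGroupι_injective B.connectedEtaleIdem B.connectedEtaleIdem_comp_self B.connectedPartHeight
      B.finrank_fixLayer_connectedEtaleIdem
    change (B.connectedPartAction β (a * b)).comp B.connectedPartι = ((B.connectedPartAction β b).comp (B.connectedPartAction β a)).comp B.connectedPartι
    rw [connectedPartAction_comp_ι, hmul, Hom.comp_assoc, connectedPartAction_comp_ι, ← Hom.comp_assoc (B.connectedPartAction β b),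
      connectedPartAction_comp_ι, Hom.comp_assoc]
  · -- additivity on the `n`-th layer, checked after the monomorphic homomorphism `ι_n`
    letI := B.grpObj n
    haveI := B.comm n
    letI := B.connectedPart.grpObj n
    haveI : IsMonHom (B.connectedPartι.app n) := B.connectedPartι.isMonHom_app n
    haveI : Mono (B.connectedPartι.app n) := B.connectedEtaleIdem.mono_fixLayerι n
    have hι : ∀ c : 𝒪, (B.connectedPartAction β c).app n ≫ B.connectedPartι.app n = B.connectedPartι.app n ≫ (β c).app n :=
      fun c => congrArg (fun K => Hom.app K n) (B.connectedPartAction_comp_ι β c)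
    rw [← cancel_mono (B.connectedPartι.app n), hι, hadd a b n, comp_lift_assoc, ← hι a, ← hι b, ← lift_map_assoc, Category.assoc,
      ← IsMonHom.mul_hom]

end Action

/-! ## §4 HEAD — the text of `stub_N1_unitComponentBTGroup` (P6b «BLOCK NUMERICS» ED. 1) -/

/-- **THE CONNECTED PART OF A BARSOTTI–TATE GROUP OVER AN ALGEBRAICALLY CLOSED FIELD IS A BARSOTTI–TATE GROUP, AND A RING ACTION RESTRICTS.**
For `B` of height `H` over `Spec k` (`k` algebraically closed, `p` prime) and a ring action `β : 𝒪 → End(B)`: there are `H⁰ ≤ H`, a Barsotti–Tate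
group `B⁰` of height `H⁰`, a homomorphism `ι : B⁰ → B` whose layers are OPEN AND CLOSED immersions with CONNECTED source (the unit components of the
`B.G n`), and a ring action `β⁰` of `𝒪` on `B⁰` with `β⁰ a ≫ ι = ι ≫ β a`.  This is VERBATIM the registered stub `stub_N1_unitComponentBTGroup` of
`Cruxes/HLiu418/Lines/F0_P6b_BlockNumerics.lean` ED. 1 (its idle DVR∕residue-field instances on `𝒪` dropped). [cite: Tate1967, §2.2 and (2.4)]
[cite: Messing1972, Ch. II (3.3.18)] [cite: Tate1997FiniteFlatGroupSchemes, (3.7)] -/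
theorem exists_connectedPart_ringAction [Fact p.Prime] {𝒪 : Type v} [CommRing 𝒪]
    (β : 𝒪 → Hom B B) (hβ : IsRingActionBT B β) :
    ∃ (H₀ : ℕ) (B₀ : BTGroup (Spec (.of k)) p H₀) (ι₀ : Hom B₀ B) (β₀ : 𝒪 → Hom B₀ B₀),
      H₀ ≤ H ∧ (∀ n, IsOpenImmersion (ι₀.app n).left ∧ IsClosedImmersion (ι₀.app n).left ∧ ConnectedSpace ↥(B₀.G n).left) ∧
      IsRingActionBT B₀ β₀ ∧ ∀ a, (β₀ a).comp ι₀ = ι₀.comp (β a) :=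
  ⟨B.connectedPartHeight, B.connectedPart, B.connectedPartι, B.connectedPartAction β, B.connectedPartHeight_le,
    fun n => ⟨B.isOpenImmersion_connectedPartι_app n, B.isClosedImmersion_connectedPartι_app n, B.connectedSpace_connectedPart n⟩,
    B.isRingActionBT_connectedPartAction β hβ, B.connectedPartAction_comp_ι β⟩

end BTGroup

end Literature.AlgebraicGeometry.GroupSchemes

end
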